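import Mathlib
import Summits.Ventures.PercRepro2.Defs
import Summits.Ventures.PercRepro2.Independence

/-!
# Independence and the tower identity for observables (blind cell PercRepro2, p1)

* `expect_mul_eq_mul_of_dependsOn`: the product rule `E(f g) = E f · E g` for observables
  determined by disjoint edge sets (the observable version of `prob_inter_eq_mul_of_dependsOn`);
* `expect_tower`: if the level sets of a statistic `S` are determined by edge sets disjoint from
  those determining the observables `Φ T`, then `E[ω ↦ Φ (S ω) ω] = ∑_ω weight p ω · E[Φ (S ω)]`
  — the finite-sum form of "condition on the explored region, the rest is fresh".
-/

namespace Summit.Ventures.PercRepro2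

/-! ## Independence for observables -/

section FunIndependence

variable {E : Type*} [Fintype E] [DecidableEq E] {R : Type*} [CommRing R]

/-- **Product rule for observables**: if `f` is determined by the edges in `F` and `g` by the
edges outside `F`, then `E(f g) = E f · E g`. -/
theorem expect_mul_eq_mul_of_dependsOn_compl (p : E → R) (F : Set E) [DecidablePred (· ∈ F)]
    {f g : Config E → R} (hf : DependsOn f F) (hg : DependsOn g Fᶜ) :
    expect p (f * g) = expect p f * expect p g := by
  let a : ({e // e ∈ F} → Bool) → R := fun σ₁ => f (glue F σ₁ fun _ => false)
  let b : ({e // e ∉ F} → Bool) → R := fun σ₂ => g (glue F (fun _ => false) σ₂)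
  have ha : ∀ σ₁ σ₂, f (glue F σ₁ σ₂) = a σ₁ := fun σ₁ σ₂ =>
    hf fun i hi => by rw [glue_apply_of_mem F _ _ hi, glue_apply_of_mem F _ _ hi]
  have hb : ∀ σ₁ σ₂, g (glue F σ₁ σ₂) = b σ₂ := fun σ₁ σ₂ =>
    hg fun i hi => by rw [glue_apply_of_notMem F _ _ hi, glue_apply_of_notMem F _ _ hi]
  have hsum₁ : ∑ σ₁ : {e // e ∈ F} → Bool, weight (fun i : {e // e ∈ F} => p i) σ₁ = 1 :=
    sum_weight _
  have hsum₂ : ∑ σ₂ : {e // e ∉ F} → Bool, weight (fun i : {e // e ∉ F} => p i) σ₂ = 1 :=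
    sum_weight _
  have e1 : expect p f = ∑ σ₁, weight (fun i : {e // e ∈ F} => p i) σ₁ * a σ₁ := by
    rw [expect_eq_sum_glue p _ F]
    refine Finset.sum_congr rfl fun σ₁ _ => ?_
    calc ∑ σ₂, weight (fun i : {e // e ∈ F} => p i) σ₁ * weight (fun i : {e // e ∉ F} => p i) σ₂
          * f (glue F σ₁ σ₂)
        = ∑ σ₂, (weight (fun i : {e // e ∈ F} => p i) σ₁ * a σ₁) *
            weight (fun i : {e // e ∉ F} => p i) σ₂ :=
          Finset.sum_congr rfl fun σ₂ _ => by rw [ha]; ring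
      _ = weight (fun i : {e // e ∈ F} => p i) σ₁ * a σ₁ := by
          rw [← Finset.mul_sum, hsum₂, mul_one]
  have e2 : expect p g = ∑ σ₂, weight (fun i : {e // e ∉ F} => p i) σ₂ * b σ₂ := by
    rw [expect_eq_sum_glue p _ F, Finset.sum_comm]
    refine Finset.sum_congr rfl fun σ₂ _ => ?_
    calc ∑ σ₁, weight (fun i : {e // e ∈ F} => p i) σ₁ * weight (fun i : {e // e ∉ F} => p i) σ₂
          * g (glue F σ₁ σ₂)
        = ∑ σ₁, (weight (fun i : {e // e ∉ F} => p i) σ₂ * b σ₂) *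
            weight (fun i : {e // e ∈ F} => p i) σ₁ :=
          Finset.sum_congr rfl fun σ₁ _ => by rw [hb]; ring
      _ = weight (fun i : {e // e ∉ F} => p i) σ₂ * b σ₂ := by
          rw [← Finset.mul_sum, hsum₁, mul_one]
  have e3 : expect p (f * g) = (∑ σ₁, weight (fun i : {e // e ∈ F} => p i) σ₁ * a σ₁) *
      ∑ σ₂, weight (fun i : {e // e ∉ F} => p i) σ₂ * b σ₂ := by
    rw [expect_eq_sum_glue p _ F, Finset.sum_mul_sum]
    refine Finset.sum_congr rfl fun σ₁ _ => Finset.sum_congr rfl fun σ₂ _ => ?_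
    rw [Pi.mul_apply, ha, hb]
    ring
  rw [e1, e2, e3]

/-- **Product rule for observables determined by disjoint edge sets**. -/
theorem expect_mul_eq_mul_of_dependsOn (p : E → R) {F₁ F₂ : Set E} (hF : Disjoint F₁ F₂)
    {f g : Config E → R} (hf : DependsOn f F₁) (hg : DependsOn g F₂) :
    expect p (f * g) = expect p f * expect p g := by
  classical
  exact expect_mul_eq_mul_of_dependsOn_compl p F₁ hf
    (DependsOn.mono (fun e he heF => Set.disjoint_left.1 hF heF he) hg)

omit [Fintype E] [DecidableEq E] in
/-- Products of observables determined by `F` are determined by `F`. -/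
lemma dependsOn_mul {F : Set E} {f g : Config E → R} (hf : DependsOn f F) (hg : DependsOn g F) :
    DependsOn (f * g) F := by
  intro ω ω' h
  simp only [Pi.mul_apply, hf h, hg h]

omit [Fintype E] [DecidableEq E] in
/-- The indicator of an event determined by `F` is an observable determined by `F`. -/
lemma dependsOn_indicator {F : Set E} {A : Set (Config E)} (hA : DependsOn (· ∈ A) F) :
    DependsOn (A.indicator (1 : Config E → R)) F := by
  intro ω ω' h
  have hiff : ω ∈ A ↔ ω' ∈ A := dependsOn_mem_iff hA h
  by_cases hω : ω ∈ A
  · have hω' : ω' ∈ A := hiff.1 hω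
    simp [hω, hω']
  · have hω' : ω' ∉ A := fun h' => hω (hiff.2 h')
    simp [hω, hω']

/-- **Tower identity for observables**: if, for every value `T`, the level set `{S = T}` of the
statistic `S` is determined by the edges of `F₁ T` and the observable `Φ T` by the edges of
`F₂ T`, with `F₁ T`, `F₂ T` disjoint, then `E[ω ↦ Φ (S ω) ω] = ∑_ω weight p ω · E[Φ (S ω)]`. -/
theorem expect_tower (p : E → R) {α : Type*} [Fintype α] [DecidableEq α] {F₁ F₂ : α → Set E}
    (hF : ∀ T, Disjoint (F₁ T) (F₂ T)) {S : Config E → α}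
    (hS : ∀ T, DependsOn (· ∈ {ω | S ω = T}) (F₁ T)) {Φ : α → Config E → R}
    (hΦ : ∀ T, DependsOn (Φ T) (F₂ T)) :
    expect p (fun ω => Φ (S ω) ω) = ∑ ω, weight p ω * expect p (Φ (S ω)) := by
  classical
  have h1 : expect p (fun ω => Φ (S ω) ω) =
      ∑ T, expect p (({ω | S ω = T} : Set (Config E)).indicator 1 * Φ T) := by
    unfold expect
    rw [← Finset.sum_fiberwise_of_maps_to (s := Finset.univ) (t := Finset.univ) (g := S)
      (fun _ _ => Finset.mem_univ _)]
    refine Finset.sum_congr rfl fun T _ => ?_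
    rw [Finset.sum_filter]
    refine Finset.sum_congr rfl fun ω _ => ?_
    by_cases hT : S ω = T
    · rw [if_pos hT]
      simp only [Pi.mul_apply, Set.indicator_of_mem (show ω ∈ {ω | S ω = T} from hT),
        Pi.one_apply, one_mul, hT]
    · rw [if_neg hT]
      simp only [Pi.mul_apply, Set.indicator_of_notMem (show ω ∉ {ω | S ω = T} from hT),
        zero_mul, mul_zero]
  have h2 : ∀ T, expect p (({ω | S ω = T} : Set (Config E)).indicator 1 * Φ T) =
      prob p {ω | S ω = T} * expect p (Φ T) := by
    intro T
    rw [expect_mul_eq_mul_of_dependsOn p (hF T) (dependsOn_indicator (hS T)) (hΦ T),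
      prob_eq_expect_indicator]
  rw [h1]
  simp_rw [h2]
  rw [← Finset.sum_fiberwise_of_maps_to (s := Finset.univ) (t := Finset.univ) (g := S)
    (fun _ _ => Finset.mem_univ _) (fun ω => weight p ω * expect p (Φ (S ω)))]
  refine Finset.sum_congr rfl fun T _ => ?_
  rw [prob_eq_sum_filter p {ω | S ω = T}, Finset.sum_mul]
  refine Finset.sum_congr ?_ fun ω hω => ?_
  · ext ω; simp
  · rw [(Finset.mem_filter.1 hω).2]

end FunIndependence

end Summit.Ventures.PercRepro2
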